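import Summits.Ventures.Crystal3D.Theorems.StickyWulffConstantPolycrystalWulffBoundInclinedLamellarTexturePrelim
import Summits.Ventures.Crystal3D.Theorems.StickyWulffConstantTextureLiminfPolytopeCalculus

/-!
# `PolycrystalWulffBound`, line `PolyDensity`: **P for inclined lamellar twin textures, in the crux's own
# energy** — `6·2^{1/3}(√2·Vol)^{2/3} ≤ En` (crux `stmt-Ventures-19482`)

Route `StickyWulffConstant` of the venture `Summits/Ventures/Crystal3D`, second prover lane (poly-p2,
gen 9).  The texture form of the unconditional rung `rung_inclinedLamellar_twin_local_half`
(`…TwinSectionShiftHolds.lean`): a texture `Tex (n'+1) G A c m` presented by a cell family adapted to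
parallel wall planes `⟪x, ν⟫ = a_f` (clause-(B) data: pairwise disjoint bounded open polytopes with
common-plane unit normals; the lamella `f` is `E ∩ {a_f < ⟪x,ν⟫ < a_{f+1}}` and also the union of its
cells; every cell carries its upper wall constraint; GENERAL POSITION: the upper wall face of every cell
of lamella `i` is covered by the closures of the cells of lamella `i+1`, and no cell of the top lamella
touches the top plane; across a wall the common-plane normals are `±ν`), with all frames co-axial about
`m₀` (`Ax m₀`), consecutive lamellae twins of each other (different lattices) whose wall data record the
axis `m₀`, satisfies the crux's inequality `6·2^{1/3}(√2·Vol)^{2/3} ≤ En (n'+1) G A c m`.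
Chain: `En = Fr + walls`; walls `≥ Σ_{adjacent} ½·ι_{Dsc m₀}(G_i, G_{i+1})` (`c ≥ ½` by `Tex`, `ι ≥ 0`,
`sum_offDiag_ge_sum_adjacent`); `ι ≥ sin∠·Σ facetArea(Q̄_a ∩ Q̄_b)` (`crossArea_le_iota_of_polytopeCalculus`
+ `crossSum_eq_sum_facetArea`, `stub_polytopeCalculus`); `Σ_a facetArea(Q̄_a ∩ P_f) ≤` that
(`facetArea_le_sum_of_subset_iUnion`, general position); the one-sided slab bounds with
`S_f = Σ_a facetArea(Q̄_a ∩ P_f) + ε` (`volume_slab_le_of_cells`); the rung; `ε → 0`.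
WHAT THIS IS NOT: textures whose consecutive lamellae share a lattice (merge them first), free facets in
wall planes, fans, multi-axis colonies; the crux is not claimed. -/

noncomputable section

open scoped BigOperators InnerProductSpace ENNReal Pointwise Topology
open MeasureTheory Filter Set

namespace Summit.Ventures.Crystal3D.Cruxes.PolycrystalWulffBound.PolyDensity

open Summit.Ventures.Crystal3D.Theorems
open Summit.Ventures.Crystal3D.Cruxes.TextureLiminf.TexShadow (per polytope facetArea supportFn E3
  stub_polytopeCalculus)
open Literature.MathematicalPhysics.StatisticalMechanics (fccStacking barlowStacking IsHaggSeq perimeter)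

set_option maxHeartbeats 800000 in
/-- **Rung `rung_inclinedLamellar_texture`**: inclined lamellar twin textures presented by a cell family
adapted to the wall planes satisfy `6·2^{1/3}(√2·Vol)^{2/3} ≤ En`. -/
theorem rung_inclinedLamellar_texture :

    let Λ : Set (EuclideanSpace ℝ (Fin 3)) := Literature.MathematicalPhysics.StatisticalMechanics.fccStacking 1 (Real.sqrt (2 / 3));
    let Brl : (ℤ → ℤ) → Set (EuclideanSpace ℝ (Fin 3)) := Literature.MathematicalPhysics.StatisticalMechanics.barlowStacking 1 (Real.sqrt (2 / 3));
    let Ax : EuclideanSpace ℝ (Fin 3) → (EuclideanSpace ℝ (Fin 3) ≃ₗᵢ[ℝ] EuclideanSpace ℝ (Fin 3)) → (EuclideanSpace ℝ (Fin 3) ≃ₗᵢ[ℝ] EuclideanSpace ℝ (Fin 3)) → Prop := fun m A B => ∃ (L : EuclideanSpace ℝ (Fin 3) ≃ₗᵢ[ℝ] EuclideanSpace ℝ (Fin 3)) (s₁ s₂ : EuclideanSpace ℝ (Fin 3)) (σ σ' : ℤ → ℤ), Literature.MathematicalPhysics.StatisticalMechanics.IsHaggSeq σ ∧ Literature.MathematicalPhysics.StatisticalMechanics.IsHaggSeq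 σ' ∧ L (EuclideanSpace.single (2 : Fin 3) (1 : ℝ)) = m ∧ A '' Λ ⊆ (fun q => L q + s₁) '' Brl σ ∧ B '' Λ ⊆ (fun q => L q + s₂) '' Brl σ';
    let CoAx : (EuclideanSpace ℝ (Fin 3) ≃ₗᵢ[ℝ] EuclideanSpace ℝ (Fin 3)) → (EuclideanSpace ℝ (Fin 3) ≃ₗᵢ[ℝ] EuclideanSpace ℝ (Fin 3)) → Prop := fun A B => ∃ m, Ax m A B;
    let Φ : EuclideanSpace ℝ (Fin 3) → ℝ := fun ν => Real.sqrt 2 / 4 * ∑ᶠ w ∈ {w ∈ Λ | ‖w‖ = 1}, |⟪w, ν⟫_ℝ|;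
    let Per : Set (EuclideanSpace ℝ (Fin 3)) → Set (EuclideanSpace ℝ (Fin 3)) → ℝ := fun K S => (⨆ (ξ : EuclideanSpace ℝ (Fin 3) → EuclideanSpace ℝ (Fin 3)) (_ : ContDiff ℝ 1 ξ ∧ HasCompactSupport ξ ∧ ∀ z, ξ z ∈ K), ENNReal.ofReal (∫ z in S, Literature.MathematicalPhysics.StatisticalMechanics.fieldDivergence ξ z)).toReal;
    let ι : Set (EuclideanSpace ℝ (Fin 3)) → Set (EuclideanSpace ℝ (Fin 3)) → Set (EuclideanSpace ℝ (Fin 3)) → ℝ := fun K S₁ S₂ => (Per K S₁ + Per K S₂ - Per K (S₁ ∪ S₂)) / 2;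
    let W : (EuclideanSpace ℝ (Fin 3) ≃ₗᵢ[ℝ] EuclideanSpace ℝ (Fin 3)) → Set (EuclideanSpace ℝ (Fin 3)) := fun A => {y | ∀ ν : EuclideanSpace ℝ (Fin 3), ⟪y, ν⟫_ℝ ≤ Φ (A.symm ν)};
    let Dsc : EuclideanSpace ℝ (Fin 3) → Set (EuclideanSpace ℝ (Fin 3)) := fun m => {y | ‖y‖ ≤ 1 ∧ ⟪y, m⟫_ℝ = 0};
    let Tex : (n : ℕ) → (Fin n → Set (EuclideanSpace ℝ (Fin 3))) → (Fin n → (EuclideanSpace ℝ (Fin 3) ≃ₗᵢ[ℝ] EuclideanSpace ℝ (Fin 3))) → (Fin n → Fin n → ℝ) → (Fin n → Fin n → EuclideanSpace ℝ (Fin 3)) → Prop := fun n G A c m => (∀ f : Fin n, Literature.MathematicalPhysics.StatisticalMechanics.HasFinitePerimeter (G f) ∧ volume (G f) < ⊤) ∧ (∀ f g, f ≠ g → Disjoint (G f) (G g)) ∧ (∀ f g, f ≠ g → 0 ≤ c f g) ∧ (∀ f g, f ≠ g → ¬ CoAx (A f) (A g) → m f g = 0 ∧ 1 ≤ c f g)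 ∧ (∀ f g, f ≠ g → CoAx (A f) (A g) → A f '' Λ ≠ A g '' Λ → Ax (m f g) (A f) (A g) ∧ 1 / 2 ≤ c f g);
    let En : (n : ℕ) → (Fin n → Set (EuclideanSpace ℝ (Fin 3))) → (Fin n → (EuclideanSpace ℝ (Fin 3) ≃ₗᵢ[ℝ] EuclideanSpace ℝ (Fin 3))) → (Fin n → Fin n → ℝ) → (Fin n → Fin n → EuclideanSpace ℝ (Fin 3)) → ℝ := fun n G A c m => ∑ f : Fin n, Per (W (A f)) (G f) - ∑ f, ∑ g, (if f = g then 0 else ι (W (A f)) (G f) (G g)) + ∑ f, ∑ g, (if f = g then 0 else c f g / 2 * ι (Dsc (m f g)) (G f) (G g));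
    let Vol : (n : ℕ) → (Fin n → Set (EuclideanSpace ℝ (Fin 3))) → ℝ := fun n G => (volume (⋃ f : Fin n, G f)).toReal;
    ∀ (k' : ℕ) (Hc : Fin k' → Finset ((EuclideanSpace ℝ (Fin 3)) × ℝ)) (nv : Fin k' → Fin k' → EuclideanSpace ℝ (Fin 3)),
      (∀ j, Bornology.IsBounded (polytope (Hc j))) →
      (∀ j j', j ≠ j' → Disjoint (polytope (Hc j)) (polytope (Hc j'))) →
      (∀ j j', j ≠ j' → ‖nv j j'‖ = 1 ∧ ∃ b : ℝ,
        closure (polytope (Hc j)) ∩ closure (polytope (Hc j')) ⊆ {x | ⟪nv j j', x⟫_ℝ = b}) →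
      (∀ j, ∀ q ∈ Hc j, ‖q.1‖ = 1) →
    ∀ (n' : ℕ) (G : Fin (n' + 1) → Set (EuclideanSpace ℝ (Fin 3)))
      (A : Fin (n' + 1) → (EuclideanSpace ℝ (Fin 3) ≃ₗᵢ[ℝ] EuclideanSpace ℝ (Fin 3)))
      (c : Fin (n' + 1) → Fin (n' + 1) → ℝ) (m : Fin (n' + 1) → Fin (n' + 1) → EuclideanSpace ℝ (Fin 3)),
      Tex (n' + 1) G A c m →
    ∀ (nrm : EuclideanSpace ℝ (Fin 3)), ‖nrm‖ = 1 → ∀ (a : Fin (n' + 2) → ℝ), StrictMono a →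
    ∀ (s : Fin (n' + 1) → Finset (Fin k')),
      (∀ f, G f = (⋃ j, polytope (Hc j)) ∩ {x | a f.castSucc < ⟪x, nrm⟫_ℝ ∧ ⟪x, nrm⟫_ℝ < a f.succ}) →
      (∀ f, G f = ⋃ j ∈ s f, polytope (Hc j)) →
      (∀ f g, f ≠ g → Disjoint (s f) (s g)) →
      (∀ f, ∀ j ∈ s f, (nrm, a f.succ) ∈ Hc j) →
      (∀ i : Fin n', ∀ j ∈ s i.castSucc, closure (polytope (Hc j)) ∩ {x | ⟪nrm, x⟫_ℝ = a i.castSucc.succ} ⊆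
        ⋃ j' ∈ s i.succ, closure (polytope (Hc j'))) →
      (∀ j ∈ s (Fin.last n'), closure (polytope (Hc j)) ∩ {x | ⟪nrm, x⟫_ℝ = a (Fin.last n').succ} = ∅) →
      (∀ i : Fin n', ∀ j ∈ s i.castSucc, ∀ j' ∈ s i.succ,
        (nv j j' = nrm ∨ nv j j' = -nrm) ∧ (nv j' j = nrm ∨ nv j' j = -nrm)) →
    ∀ (m₀ : EuclideanSpace ℝ (Fin 3)), (∀ f g, Ax m₀ (A f) (A g)) →
      (∀ i : Fin n', m i.castSucc i.succ = m₀ ∧ m i.succ i.castSucc = m₀ ∧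
        A i.castSucc '' Λ ≠ A i.succ '' Λ) →
    6 * (2 : ℝ) ^ ((1 : ℝ) / 3) * (Real.sqrt 2 * Vol (n' + 1) G) ^ ((2 : ℝ) / 3) ≤ En (n' + 1) G A c m := by
  intro Λ Brl Ax CoAx Φ Per ι W Dsc Tex En Vol k' Hc nv hbd hdisjQ hplane hunit n' G A c m hTex
    nrm hnrm a ha s hG hGs hsdisj hwall hGP hGPtop hnv m₀ hAx hadj
  classical
  obtain ⟨hfin, hdisjG, hc0, -, htwin⟩ := hTex
  have hvol : ∀ f, volume (G f) < ⊤ := fun f => (hfin f).2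
  have hPC := stub_polytopeCalculus
  have hnrm0 : nrm ≠ 0 := by
    intro h; rw [h, norm_zero] at hnrm; exact zero_ne_one hnrm
  have hm₀ : ‖m₀‖ = 1 := by
    obtain ⟨L, -, -, -, -, -, -, hLm, -, -⟩ := hAx 0 0
    rw [← hLm, LinearIsometryEquiv.norm_map, PiLp.norm_single, norm_one]
  -- the whole set
  set E : Set E3 := ⋃ j, polytope (Hc j) with hE
  have hEpoly : ∃ (k : ℕ) (H : Fin k → Finset (E3 × ℝ)), E = ⋃ i, ⋂ p ∈ H i, {x : E3 | ⟪p.1, x⟫_ℝ < p.2} :=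
    ⟨k', Hc, rfl⟩
  have hEvol : volume E < ⊤ := by
    refine lt_of_le_of_lt (measure_iUnion_le _) ?_
    rw [tsum_fintype]
    exact ENNReal.sum_lt_top.2 fun j _ => (hbd j).measure_lt_top
  have hGpoly : ∀ f, ∃ (k : ℕ) (H : Fin k → Finset (E3 × ℝ)), G f = ⋃ i, polytope (H i) := by
    intro f
    refine ⟨(s f).card, fun i => Hc ((s f).equivFin.symm i), ?_⟩
    rw [hGs f]
    ext x
    simp only [mem_iUnion]
    constructor
    · rintro ⟨j, hj, hx⟩
      exact ⟨(s f).equivFin ⟨j, hj⟩, by simpa using hx⟩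
    · rintro ⟨i, hx⟩
      exact ⟨((s f).equivFin.symm i : Fin k'), ((s f).equivFin.symm i).2, hx⟩
  -- the wall body
  have hDc : ∀ v : E3, IsCompact (Dsc v) := fun v =>
    Metric.isCompact_of_isClosed_isBounded
      ((isClosed_le continuous_norm continuous_const).inter
        (isClosed_eq (continuous_id.inner continuous_const) continuous_const))
      (Metric.isBounded_closedBall.subset (cruxDisc_subset_closedBall v))
  have hι_nonneg : ∀ (v : E3) (f g : Fin (n' + 1)), f ≠ g → 0 ≤ ι (Dsc v) (G f) (G g) := by
    intro v f g hfg
    have h := iota_nonneg_of_poly G hGpoly hvol hdisjG (hDc v) (convex_cruxDisc v) (zero_mem_cruxDisc v) hfg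
    show 0 ≤ (per (Dsc v) (G f) + per (Dsc v) (G g) - per (Dsc v) (G f ∪ G g)) / 2
    exact div_nonneg h zero_le_two
  have hι_symm : ∀ (v : E3) (f g : Fin (n' + 1)), ι (Dsc v) (G f) (G g) = ι (Dsc v) (G g) (G f) := by
    intro v f g
    show (per (Dsc v) (G f) + per (Dsc v) (G g) - per (Dsc v) (G f ∪ G g)) / 2 =
      (per (Dsc v) (G g) + per (Dsc v) (G f) - per (Dsc v) (G g ∪ G f)) / 2
    rw [Set.union_comm (G g), add_comm (per (Dsc v) (G g))]
  -- wall areas and cross areas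
  set Area : Fin (n' + 1) → ℝ := fun f => ∑ j ∈ s f,
    facetArea (closure (polytope (Hc j)) ∩ {x : E3 | ⟪nrm, x⟫_ℝ = a f.succ}) nrm with hArea
  set X : Fin n' → ℝ := fun i => ∑ j ∈ s i.castSucc, ∑ j' ∈ s i.succ,
    facetArea (closure (polytope (Hc j)) ∩ closure (polytope (Hc j'))) nrm with hX
  set sθ : ℝ := Real.sqrt (1 - ⟪nrm, m₀⟫_ℝ ^ 2) with hsθ
  have hsθ0 : 0 ≤ sθ := Real.sqrt_nonneg _
  -- (1) the wall areas are dominated by the cross areas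
  have hArea_le : ∀ i : Fin n', Area i.castSucc ≤ X i := by
    intro i
    simp only [hArea, hX]
    refine Finset.sum_le_sum fun j hj => ?_
    rw [show a i.castSucc.succ = a i.castSucc.succ from rfl]
    refine facetArea_le_sum_of_subset_iUnion (s i.succ) _ _ nrm ?_ ?_
    · intro x hx
      have hx' := hGP i j hj hx
      obtain ⟨j', hj', hxj'⟩ := mem_iUnion₂.1 hx'
      exact mem_iUnion₂.2 ⟨j', hj', hx.1, hxj'⟩
    · intro j' _
      exact volume_prism_ne_top_of_isBounded (hbd j) _ inter_subset_left nrm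
  have hArea_last : Area (Fin.last n') = 0 := by
    simp only [hArea]
    refine Finset.sum_eq_zero fun j hj => ?_
    rw [hGPtop j hj]
    simp [facetArea]
  have hsumArea : ∑ f, Area f ≤ ∑ i, X i := by
    rw [Fin.sum_univ_castSucc, hArea_last, add_zero]
    exact Finset.sum_le_sum fun i _ => hArea_le i
  -- (2) the cross areas are dominated by the interface terms
  have hX_le : ∀ i : Fin n', sθ * X i ≤ ι (Dsc m₀) (G i.castSucc) (G i.succ) := by
    intro i
    have hne : i.castSucc ≠ i.succ := (show i.castSucc < i.succ from Fin.castSucc_lt_succ).ne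
    have hAB : Disjoint (s i.castSucc) (s i.succ) := hsdisj _ _ hne
    have h := crossArea_le_iota_of_polytopeCalculus hPC hm₀ hnrm Hc nv hbd hdisjQ hplane hAB (hnv i)
    rw [crossSum_eq_sum_facetArea hnrm Hc nv hplane hAB (hnv i)] at h
    have hunion : (⋃ j ∈ s i.castSucc ∪ s i.succ, polytope (Hc j)) = G i.castSucc ∪ G i.succ := by
      rw [hGs i.castSucc, hGs i.succ, Finset.set_biUnion_union]
    rw [hunion, ← hGs i.castSucc, ← hGs i.succ] at h
    exact h
  -- (3) the wall terms of the energy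
  have hwalls : sθ / 2 * ∑ f, Area f ≤
      ∑ f, ∑ g, (if f = g then 0 else c f g / 2 * ι (Dsc (m f g)) (G f) (G g)) := by
    have hadj_sum := sum_offDiag_ge_sum_adjacent
      (fun f g => c f g / 2 * ι (Dsc (m f g)) (G f) (G g))
      (fun f g hfg => mul_nonneg (div_nonneg (hc0 f g hfg) zero_le_two) (hι_nonneg _ f g hfg))
    refine le_trans ?_ hadj_sum
    have hpair : ∀ i : Fin n', sθ / 2 * X i ≤
        c i.castSucc i.succ / 2 * ι (Dsc (m i.castSucc i.succ)) (G i.castSucc) (G i.succ) +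
        c i.succ i.castSucc / 2 * ι (Dsc (m i.succ i.castSucc)) (G i.succ) (G i.castSucc) := by
      intro i
      obtain ⟨hm1, hm2, hne⟩ := hadj i
      have hlt : i.castSucc ≠ i.succ := (show i.castSucc < i.succ from Fin.castSucc_lt_succ).ne
      have hco : CoAx (A i.castSucc) (A i.succ) := ⟨m₀, hAx _ _⟩
      have hco' : CoAx (A i.succ) (A i.castSucc) := ⟨m₀, hAx _ _⟩
      have hc1 : 1 / 2 ≤ c i.castSucc i.succ := (htwin _ _ hlt hco hne).2
      have hc2 : 1 / 2 ≤ c i.succ i.castSucc := (htwin _ _ hlt.symm hco' hne.symm).2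
      rw [hm1, hm2, hι_symm m₀ i.succ i.castSucc]
      have hι0 := hι_nonneg m₀ _ _ hlt
      have hXι := hX_le i
      nlinarith
    calc sθ / 2 * ∑ f, Area f ≤ sθ / 2 * ∑ i, X i :=
          mul_le_mul_of_nonneg_left hsumArea (by positivity)
      _ = ∑ i, sθ / 2 * X i := Finset.mul_sum _ _ _
      _ ≤ _ := Finset.sum_le_sum fun i _ => hpair i
  -- (4) the rung with `S_f = Area_f + ε`, for every `ε > 0`
  have hFr_le : ∀ ε : ℝ, 0 < ε →
      6 * (2 : ℝ) ^ ((1 : ℝ) / 3) * (Real.sqrt 2 * Vol (n' + 1) G) ^ ((2 : ℝ) / 3) ≤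
        (∑ f, Per (W (A f)) (G f) - ∑ f, ∑ g, (if f = g then 0 else ι (W (A f)) (G f) (G g))) +
          1 / 2 * sθ * ∑ f, (Area f + ε) := by
    intro ε hε
    -- thresholds, lamella by lamella
    have hthr : ∀ f : Fin (n' + 1), ∃ h₀ : ℝ, 0 < h₀ ∧ ∀ h : ℝ, 0 < h → h < h₀ →
        volume ((⋃ j ∈ s f, polytope (Hc j)) ∩
          {x : E3 | a f.succ - h ≤ ⟪x, nrm⟫_ℝ ∧ ⟪x, nrm⟫_ℝ < a f.succ}) ≤
          ENNReal.ofReal (h * (Area f + ε)) :=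
      fun f => volume_slab_le_of_cells Hc hbd hunit (s f) hnrm0 (hwall f) hε
    choose h₁ hh₁ hslab using hthr
    have hgap : ∀ f : Fin (n' + 1), 0 < a f.succ - a f.castSucc := fun f =>
      sub_pos.2 (ha (show f.castSucc < f.succ from Fin.castSucc_lt_succ))
    set h₀ : ℝ := Finset.univ.inf' Finset.univ_nonempty
      (fun f : Fin (n' + 1) => min (h₁ f) (a f.succ - a f.castSucc)) with hh₀
    have hh₀pos : 0 < h₀ := by
      rw [hh₀, Finset.lt_inf'_iff]
      intro f _
      exact lt_min (hh₁ f) (hgap f)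
    have hh₀le₁ : ∀ f, h₀ ≤ h₁ f := fun f =>
      (Finset.inf'_le _ (Finset.mem_univ f)).trans (min_le_left _ _)
    have hh₀le₂ : ∀ f : Fin (n' + 1), h₀ ≤ a f.succ - a f.castSucc := fun f =>
      (Finset.inf'_le _ (Finset.mem_univ f)).trans (min_le_right _ _)
    -- the section bounds of the rung
    have hArea0 : ∀ f : Fin (n' + 1), 0 ≤ Area f := fun f => Finset.sum_nonneg fun j _ => ENNReal.toReal_nonneg
    have hS0 : ∀ f : Fin (n' + 1), 0 ≤ Area f + ε := fun f => add_nonneg (hArea0 f) hε.le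
    have hS : ∀ (f : Fin (n' + 1)) (h : ℝ), 0 < h → h < h₀ →
        volume (E ∩ {x : E3 | a f.succ - h ≤ ⟪x, nrm⟫_ℝ ∧ ⟪x, nrm⟫_ℝ < a f.succ}) ≤
          ENNReal.ofReal (h * (Area f + ε)) := by
      intro f h hh hhh₀
      refine le_trans (measure_mono ?_) (hslab f h hh (lt_of_lt_of_le hhh₀ (hh₀le₁ f)))
      rintro x ⟨hxE, hx1, hx2⟩
      have hxG : x ∈ G f := by
        rw [hG f]
        refine ⟨hxE, ?_, hx2⟩
        have := hh₀le₂ f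
        show a f.castSucc < ⟪x, nrm⟫_ℝ
        linarith
      rw [hGs f] at hxG
      exact ⟨hxG, hx1, hx2⟩
    have hr := rung_inclinedLamellar_twin_local_half E hEpoly hEvol m₀ nrm hnrm (n' + 1) a ha A
      (fun f => Area f + ε) hAx hS0 h₀ hh₀pos hS
    have hGfun : (fun f : Fin (n' + 1) => E ∩ {x : E3 | a f.castSucc < ⟪x, nrm⟫_ℝ ∧ ⟪x, nrm⟫_ℝ < a f.succ}) = G :=
      funext fun f => (hG f).symm
    rw [hGfun] at hr
    exact hr
  -- (5) conclusion: `ε → 0`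
  show 6 * (2 : ℝ) ^ ((1 : ℝ) / 3) * (Real.sqrt 2 * Vol (n' + 1) G) ^ ((2 : ℝ) / 3) ≤
    ∑ f, Per (W (A f)) (G f) - ∑ f, ∑ g, (if f = g then 0 else ι (W (A f)) (G f) (G g)) +
      ∑ f, ∑ g, (if f = g then 0 else c f g / 2 * ι (Dsc (m f g)) (G f) (G g))
  refine le_of_forall_pos_lt_add fun δ hδ => ?_
  have hε : 0 < δ / (sθ * (n' + 1) + 1) := by positivity
  have h := hFr_le _ hε
  have hsum : ∑ f : Fin (n' + 1), (Area f + δ / (sθ * (n' + 1) + 1)) =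
      ∑ f, Area f + (n' + 1) * (δ / (sθ * (n' + 1) + 1)) := by
    rw [Finset.sum_add_distrib, Finset.sum_const, Finset.card_univ, Fintype.card_fin, nsmul_eq_mul]
    push_cast
    ring
  rw [hsum] at h
  have hsmall : 1 / 2 * sθ * ((n' + 1) * (δ / (sθ * (n' + 1) + 1))) < δ := by
    rw [show 1 / 2 * sθ * ((n' + 1) * (δ / (sθ * (n' + 1) + 1))) =
      δ * (sθ * (n' + 1) / (sθ * (n' + 1) + 1)) / 2 by ring]
    have h1 : sθ * (n' + 1) / (sθ * (n' + 1) + 1) < 1 := by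
      rw [div_lt_one (by positivity)]; linarith
    have h2 : 0 ≤ sθ * (n' + 1) / (sθ * (n' + 1) + 1) := by positivity
    nlinarith
  nlinarith [hwalls]

end Summit.Ventures.Crystal3D.Cruxes.PolycrystalWulffBound.PolyDensity

end
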